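import Summits.CriticalPhenomena.PercolationContinuityZ3.Theses.PercSieveRigidity
import Summits.CriticalPhenomena.PercolationContinuityZ3.Theorems.PercNearOneGluingNoHeavyLowerTailCSHTheoremOne
import Literature.Probability.Percolation.PercolationProofs
import Literature.Probability.Percolation.ConnectivityProofs
import Literature.Probability.Percolation.SharpnessDCTProofs
import HarnessLib

/-!
# `PercSieveRigidity.BernoulliSieveFinite` (stmt-CriticalPhenomena-7693) — SETTLED after continuity

Item `stmt-CriticalPhenomena-7693` of route `CriticalPhenomena/PercSieveRigidity` (support): Bernoulli(p_c) on ℤ³ is sieve-fragile: for every periodic sieve `D_(L,i,c)`, `P_{p_c}`-a.s. every cluster of `ω ∖ D` is finite.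

With `θ(p_c(ℤ³)) = 0` (p205010) and translation invariance (`theta_zdGraph_eq_theta_zero`), `P_{p_c}`-a.s. every cluster of `ω` itself is finite (countably many roots, `ae_all_iff`); clusters of `ω ∖ D` are sub-clusters (`openCluster_mono`).  The hypothesis `StrictPlugSieve` is not used.

builds on p205010 (kernel theorem, internal audit signed; external expert review pending) — USED (`CSH.percolationContinuityZ3_holds`).  RSW3 lane, lead gen 28 (prover-prim-rsw3-lead-g28-0):
'after continuity — the ledger harvest'.
References: G. Kozma, N. Nitzan (2024), Thm. 6 / Conj. 3 [KozmaNitzan2024]; G. Grimmett, *Percolation* (1999), §8 [GrimmettPercolation1999].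
-/

noncomputable section

namespace Summit.CriticalPhenomena.PercolationContinuityZ3.Theorems

namespace PercSieveRigidityBernoulliSieveFinite

open MeasureTheory Literature.Probability.Percolation Literature.Probability.LatticeModels

/-- **`PercSieveRigidity.BernoulliSieveFinite` (stmt-CriticalPhenomena-7693), settled.**  a.s. all clusters finite at p_c (p205010 + translation invariance), and `openCluster_mono`.
[cite: KozmaNitzan2024, Thm. 6 with Conj. 3 (p. 15)] -/
theorem bernoulliSieveFinite_proof : Summit.CriticalPhenomena.PercolationContinuityZ3.Theses.PercSieveRigidity.BernoulliSieveFinite := by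
  unfold Summit.CriticalPhenomena.PercolationContinuityZ3.Theses.PercSieveRigidity.BernoulliSieveFinite
  intro _ L _ i c
  have h00 : theta (zdGraph 3) (0 : Site 3) (criticalProbI 3) = 0 := CSH.percolationContinuityZ3_holds
  have hae : ∀ x : Site 3, ∀ᵐ ω ∂(bondPercolation (zdGraph 3) (criticalProbI 3)), (openCluster ω x).Finite := by
    intro x
    have hx : (bondPercolation (zdGraph 3) (criticalProbI 3)).real (percolatesAt x) = 0 := by
      have h := theta_zdGraph_eq_theta_zero (criticalProbI 3) x
      rw [h00] at h
      exact h
    have hnull : bondPercolation (zdGraph 3) (criticalProbI 3) (percolatesAt x) = 0 :=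
      (measureReal_eq_zero_iff (measure_ne_top _ _)).1 hx
    rw [ae_iff]
    have hset : {ω : BondConfig (Site 3) | ¬ (openCluster ω x).Finite} = percolatesAt x := by
      ext ω; rfl
    rw [hset]
    exact hnull
  exact ae_all_iff.2 fun x => (hae x).mono fun ω hω => hω.subset (openCluster_mono Set.sdiff_subset x)

end PercSieveRigidityBernoulliSieveFinite

end Summit.CriticalPhenomena.PercolationContinuityZ3.Theorems

end
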